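import Mathlib
import Summits.KontsevichZagierPeriods.Zeta5Search.Families.CoeffAsympTypes
import Summits.KontsevichZagierPeriods.Zeta5Search.Families.CoeffAsympRational
import Summits.KontsevichZagierPeriods.Zeta5Search.Families.CoeffAsympEntropy
import Literature.Computability.AlgebraicComplexity.GlobalStageAsymptotic
import HarnessLib

/-!
# ζ(5) search — Families: coefficient asymptotics of powers of a positive polynomial, VI — the lower bound from ONE
# measure of mean `B`

HONEST FRAMING: systematic search; no irrationality claim unless certified.  Cell `pub-zeta5`, certifier 2
(cert-2 g9, 2026-08-22).  Elementary real analysis (method of types); no conjecture node is used; nothing about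
`ζ(5)`; no number of record moves.

* `entropyFun F c p = Σ_{α ∈ F} (h(p_α) + p_α log c_α)` (`h = −x log x`), `tendsto_entropyFun` (continuity along
  coordinatewise convergent sequences), `entropyFun_near` (uniform `ε` for a prescribed error);
* `exists_int_near_of_integer_system` — integer form of `Families/CoeffAsympRational`: a real solution of a homogeneous
  integer system is approximated by `K/D`, `K` an INTEGER solution, `D ≥ 1`;
* **`eventually_le_log_coeff_div`** — THE LOWER BOUND OF THE METHOD OF TYPES: if an integer vector `k ≥ 0` on `S`
  has `Σ k = D ≥ 1` and `Σ_α k_α α = D • B` (a "measure `k/D` of mean `B`"), then for every `η > 0`, eventually in `n`,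
  `entropyFun S c (k/D) − η ≤ (1/n) log [x^{nB}] (poly S c)ⁿ` — via the types `⌊n/D⌋·k + (n mod D)·δ_B` of length `n`
  and exponent `n • B`, `typeWeight_le_coeff` and the entropy bound `log_multinomial_div_ge`.
Standard axioms only.
-/

noncomputable section

open MvPolynomial Finset Real Filter Topology

namespace Summit.KontsevichZagierPeriods.Zeta5Search.Families.Cellular

namespace CoeffAsymp

variable {d : ℕ}

/-! ## The entropy functional -/

/-- `Φ_F(p) = Σ_{α ∈ F} (h(p_α) + p_α log c_α)`, `h(x) = −x log x`. -/
def entropyFun (F : Finset (Fin d →₀ ℕ)) (c : (Fin d →₀ ℕ) → ℝ) (p : (Fin d →₀ ℕ) → ℝ) : ℝ :=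
  ∑ α ∈ F, (Real.negMulLog (p α) + p α * Real.log (c α))

/-- The one-coordinate term of the entropy functional is continuous. -/
theorem continuous_entropyTerm (L : ℝ) : Continuous fun x : ℝ => Real.negMulLog x + x * L :=
  Real.continuous_negMulLog.add (continuous_id.mul continuous_const)

/-- Continuity of `Φ_F` along a coordinatewise convergent sequence. -/
theorem tendsto_entropyFun (F : Finset (Fin d →₀ ℕ)) (c : (Fin d →₀ ℕ) → ℝ) {p : ℕ → (Fin d →₀ ℕ) → ℝ}
    {q : (Fin d →₀ ℕ) → ℝ} (h : ∀ α ∈ F, Tendsto (fun n => p n α) atTop (𝓝 (q α))) :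
    Tendsto (fun n => entropyFun F c (p n)) atTop (𝓝 (entropyFun F c q)) := by
  unfold entropyFun
  refine tendsto_finsetSum F fun α hα => ?_
  exact ((continuous_entropyTerm (Real.log (c α))).tendsto (q α)).comp (h α hα)

/-- A uniform `ε` for a prescribed error of `Φ_F`. -/
theorem entropyFun_near (F : Finset (Fin d →₀ ℕ)) (c : (Fin d →₀ ℕ) → ℝ) (q : (Fin d →₀ ℕ) → ℝ) {η : ℝ}
    (hη : 0 < η) : ∃ ε : ℝ, 0 < ε ∧ ∀ p : (Fin d →₀ ℕ) → ℝ, (∀ α ∈ F, |p α - q α| < ε) →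
      |entropyFun F c p - entropyFun F c q| < η := by
  classical
  rcases F.eq_empty_or_nonempty with hF | hne
  · refine ⟨1, one_pos, fun p _ => ?_⟩
    simp [entropyFun, hF, hη]
  · have hcard : (0 : ℝ) < F.card := by exact_mod_cast Finset.card_pos.2 hne
    have hδ : ∀ α ∈ F, ∃ δ : ℝ, 0 < δ ∧ ∀ x : ℝ, |x - q α| < δ →
        |(Real.negMulLog x + x * Real.log (c α)) - (Real.negMulLog (q α) + q α * Real.log (c α))| < η / F.card := by
      intro α _
      have hc := (continuous_entropyTerm (Real.log (c α))).continuousAt (x := q α)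
      rw [Metric.continuousAt_iff] at hc
      obtain ⟨δ, hδ, h⟩ := hc (η / F.card) (div_pos hη hcard)
      exact ⟨δ, hδ, fun x hx => h hx⟩
    choose! δ hδpos hδ using hδ
    refine ⟨F.inf' hne δ, (Finset.lt_inf'_iff hne).2 hδpos, fun p hp => ?_⟩
    unfold entropyFun
    rw [← Finset.sum_sub_distrib]
    calc |∑ α ∈ F, ((Real.negMulLog (p α) + p α * Real.log (c α)) -
            (Real.negMulLog (q α) + q α * Real.log (c α)))|
        ≤ ∑ α ∈ F, |(Real.negMulLog (p α) + p α * Real.log (c α)) -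
            (Real.negMulLog (q α) + q α * Real.log (c α))| := Finset.abs_sum_le_sum_abs _ _
      _ < ∑ α ∈ F, η / F.card := by
          refine Finset.sum_lt_sum_of_nonempty hne fun α hα => hδ α hα (p α) ?_
          exact lt_of_lt_of_le (hp α hα) (Finset.inf'_le δ hα)
      _ = η := by rw [Finset.sum_const, nsmul_eq_mul]; field_simp

/-! ## Integer form of the rational approximation -/

/-- **Integer solutions near a real solution.**  If `x ∈ ℝ^ι` solves the homogeneous integer equations in `L`, then
for every `ε > 0` there are `D ≥ 1` and an INTEGER solution `K` with `|x_i − K_i/D| < ε`. -/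
theorem exists_int_near_of_integer_system {ι : Type*} [Fintype ι] (L : List (ι → ℤ)) (x : ι → ℝ)
    (hx : ∀ v ∈ L, ∑ i, x i * (v i : ℝ) = 0) {ε : ℝ} (hε : 0 < ε) :
    ∃ (D : ℕ) (K : ι → ℤ), 0 < D ∧ (∀ v ∈ L, ∑ i, K i * v i = 0) ∧ ∀ i, |x i - (K i : ℝ) / D| < ε := by
  classical
  obtain ⟨q, hqL, hqx⟩ := exists_rat_near_of_integer_system L x hx ε hε
  -- common denominator and numerators
  set D : ℕ := ∏ i, (q i).den with hD
  have hDpos : 0 < D := Finset.prod_pos fun i _ => (q i).den_pos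
  set K : ι → ℤ := fun i => (q i).num * ∏ j ∈ Finset.univ.erase i, ((q j).den : ℤ) with hK
  have hKq : ∀ i, (K i : ℚ) = q i * D := by
    intro i
    have hsplit : (D : ℚ) = (q i).den * ∏ j ∈ Finset.univ.erase i, ((q j).den : ℚ) := by
      rw [hD, Nat.cast_prod, ← Finset.mul_prod_erase Finset.univ (fun j => ((q j).den : ℚ)) (Finset.mem_univ i)]
    rw [hsplit, hK]
    push_cast
    rw [← mul_assoc, Rat.mul_den_eq_num]
  refine ⟨D, K, hDpos, fun v hv => ?_, fun i => ?_⟩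
  · have h1 : (∑ i, ((q i : ℚ) : ℝ) * (v i : ℝ)) * D = 0 := by rw [hqL v hv, zero_mul]
    rw [Finset.sum_mul] at h1
    have h2 : ∑ i, ((K i * v i : ℤ) : ℝ) = 0 := by
      rw [← h1]
      refine Finset.sum_congr rfl fun i _ => ?_
      have : ((K i : ℤ) : ℝ) = ((q i : ℚ) : ℝ) * D := by
        rw [show ((K i : ℤ) : ℝ) = ((K i : ℚ) : ℝ) by push_cast; rfl, hKq i]; push_cast; rfl
      push_cast
      rw [this]
      ring
    exact_mod_cast h2
  · have : (K i : ℝ) / D = ((q i : ℚ) : ℝ) := by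
      have hD' : (D : ℝ) ≠ 0 := by exact_mod_cast hDpos.ne'
      rw [div_eq_iff hD', show ((K i : ℤ) : ℝ) = ((K i : ℚ) : ℝ) by push_cast; rfl, hKq i]
      push_cast; rfl
    rw [this]
    exact hqx i

/-! ## The lower bound from an integer measure of mean `B` -/

/-- **The lower bound of the method of types.**  Let `c > 0` on `S`, `B ∈ S`, and let `k : monomials → ℕ` vanish off
`S` with `Σ_{α ∈ S} k_α = D ≥ 1` and `Σ_α k_α α = D • B`.  Then for every `η > 0`, eventually in `n`,
`entropyFun S c (k/D) − η ≤ (1/n) · log [x^{nB}] (poly S c)ⁿ`. -/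
theorem eventually_le_log_coeff_div {S : Finset (Fin d →₀ ℕ)} {c : (Fin d →₀ ℕ) → ℝ} (hc : ∀ α ∈ S, 0 < c α)
    {B : Fin d →₀ ℕ} (hB : B ∈ S) (k : (Fin d →₀ ℕ) → ℕ) (hkS : ∀ α, k α ≠ 0 → α ∈ S) {D : ℕ} (hD : 0 < D)
    (hsum : ∑ α ∈ S, k α = D) (hmean : typeExp S k = D • B) {η : ℝ} (hη : 0 < η) :
    ∀ᶠ n : ℕ in atTop, entropyFun S c (fun α => (k α : ℝ) / D) - η ≤
      Real.log (coeff (n • B) (poly S c ^ n)) / n := by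
  classical
  -- the types of a general length `n`
  set T : ℕ → (Fin d →₀ ℕ) → ℕ := fun n α => n / D * k α + n % D * (if α = B then 1 else 0) with hT
  have hTmem : ∀ n, T n ∈ S.piAntidiag n := by
    intro n
    rw [Finset.mem_piAntidiag]
    constructor
    · simp only [hT, Finset.sum_add_distrib, ← Finset.mul_sum, hsum, Finset.sum_ite_eq', hB, if_true, mul_one]
      exact Nat.div_add_mod' n D
    · intro α hα
      simp only [hT] at hα
      by_cases hαB : α = B
      · rw [hαB]; exact hB
      · simp only [hαB, if_false, mul_zero, add_zero] at hα
        exact hkS α (fun h0 => hα (by rw [h0, mul_zero]))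
  have hTexp : ∀ n, typeExp S (T n) = n • B := by
    intro n
    ext i
    have hk : ∑ α ∈ S, k α * α i = D * B i := by
      have h0 := congrArg (fun f : Fin d →₀ ℕ => f i) hmean
      simpa [typeExp_apply] using h0
    rw [typeExp_apply]
    simp only [hT, add_mul, Finset.sum_add_distrib, mul_assoc, ← Finset.mul_sum, hk, ite_mul, one_mul, zero_mul,
      Finset.sum_ite_eq', hB, if_true, Finsupp.smul_apply, smul_eq_mul]
    calc n / D * (D * B i) + n % D * B i = (n / D * D + n % D) * B i := by ring
      _ = n * B i := by rw [Nat.div_add_mod']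
  -- the lower bound by one type, and positivity
  have hW : ∀ n, typeWeight S c (T n) ≤ coeff (n • B) (poly S c ^ n) := fun n => by
    rw [← hTexp n]; exact typeWeight_le_coeff (fun α hα => (hc α hα).le) (hTmem n)
  have hWpos : ∀ n, 0 < typeWeight S c (T n) := fun n =>
    mul_pos (by exact_mod_cast Nat.multinomial_pos S (T n)) (Finset.prod_pos fun α hα => pow_pos (hc α hα) _)
  -- the entropy bound for the types
  have hent : ∀ n : ℕ, n ≠ 0 → entropyFun S c (fun α => (T n α : ℝ) / n) -
      S.card * (Real.log n / 2 + 1) / n ≤ Real.log (typeWeight S c (T n)) / n := by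
    intro n hn
    have hsumT : ∑ α ∈ S, T n α = n := (Finset.mem_piAntidiag.1 (hTmem n)).1
    have h := log_multinomial_div_ge S (T n) (by rw [hsumT]; exact hn)
    rw [hsumT] at h
    have hn' : (0 : ℝ) < n := by exact_mod_cast Nat.pos_of_ne_zero hn
    unfold typeWeight entropyFun
    rw [Real.log_mul (by exact_mod_cast (Nat.multinomial_pos S (T n)).ne')
      (Finset.prod_pos fun α hα => pow_pos (hc α hα) _).ne', Real.log_prod (fun α hα => (pow_pos (hc α hα) _).ne'),
      add_div, Finset.sum_add_distrib]
    have h2 : ∑ α ∈ S, (T n α : ℝ) / n * Real.log (c α) = (∑ α ∈ S, Real.log (c α ^ T n α)) / n := by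
      rw [Finset.sum_div]
      exact Finset.sum_congr rfl fun α _ => by rw [Real.log_pow]; ring
    rw [h2]
    linarith
  -- limits: `T n α / n → k α / D`, the entropy functional follows, the error term vanishes
  have hcoord : ∀ α ∈ S, Tendsto (fun n : ℕ => (T n α : ℝ) / n) atTop (𝓝 ((k α : ℝ) / D)) := by
    intro α _
    have h1 := (tendsto_natDiv_div hD.ne').mul_const (k α : ℝ)
    have h2 := (tendsto_natMod_div hD.ne').mul_const (if α = B then (1 : ℝ) else 0)
    have h3 := h1.add h2
    simp only [zero_mul, add_zero] at h3
    rw [show (k α : ℝ) / D = 1 / D * k α by ring]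
    refine h3.congr' (Eventually.of_forall fun n => ?_)
    simp only [hT]; push_cast; ring
  have hlim1 := tendsto_entropyFun S c (p := fun n α => (T n α : ℝ) / n) (q := fun α => (k α : ℝ) / D) hcoord
  have herr : Tendsto (fun n : ℕ => (S.card : ℝ) * (Real.log n / 2 + 1) / n) atTop (𝓝 0) := by
    have h1 : Tendsto (fun n : ℕ => (S.card : ℝ) * (Real.log n / n / 2 + 1 / n)) atTop (𝓝 ((S.card : ℝ) * (0 / 2 + 0))) :=
      ((Literature.Computability.AlgebraicComplexity.tendsto_log_div_nat.div_const 2).add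
        tendsto_one_div_atTop_nhds_zero_nat).const_mul _
    rw [zero_div, add_zero, mul_zero] at h1
    refine h1.congr' ((eventually_gt_atTop 0).mono fun n hn => ?_)
    have hn' : (0 : ℝ) < n := by exact_mod_cast hn
    field_simp
  have hlim : Tendsto (fun n : ℕ => entropyFun S c (fun α => (T n α : ℝ) / n) - S.card * (Real.log n / 2 + 1) / n)
      atTop (𝓝 (entropyFun S c (fun α => (k α : ℝ) / D))) := by
    simpa using hlim1.sub herr
  -- conclude
  have hev := (hlim.eventually (lt_mem_nhds (sub_lt_self _ hη)))
  filter_upwards [hev, eventually_gt_atTop 0] with n hn hn0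
  have hn' : (0 : ℝ) < n := by exact_mod_cast hn0
  calc entropyFun S c (fun α => (k α : ℝ) / D) - η
      ≤ entropyFun S c (fun α => (T n α : ℝ) / n) - S.card * (Real.log n / 2 + 1) / n := hn.le
    _ ≤ Real.log (typeWeight S c (T n)) / n := hent n hn0.ne'
    _ ≤ Real.log (coeff (n • B) (poly S c ^ n)) / n :=
        div_le_div_of_nonneg_right (Real.log_le_log (hWpos n) (hW n)) hn'.le

end CoeffAsymp

end Summit.KontsevichZagierPeriods.Zeta5Search.Families.Cellular
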